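import Mathlib
import Summits.ValiantsHypothesis.ValiantsHypothesis.Theses.GirthSidon
import Summits.ValiantsHypothesis.ValiantsHypothesis.Theorems.GirthSidonSparseSwallowForcesShortRelationPaths

/-!
# GirthSidon — `SparseSwallowForcesShortRelation` (item stmt-ValiantsHypothesis-6539)

The sparse engine of route `GirthSidon` (problem `ValiantsHypothesis`): if a quadratic map
`Γ : ℂ^s → ℂ^m` (coordinates of total degree `≤ 2`) formally swallows the monomial curve
`x ↦ (x^{d_i})_{i<m}` along Laurent polynomials `y_j ∈ ℂ[x, x⁻¹]` with at most `B` terms each,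
`Γ_i(y) = x^{d_i}`, and `(sB)^20 ≤ m^19` with `m` large, then the exponents admit a short additive
relation: multisets `S ≠ T` over `Fin m` of size `≤ 30` with `Σ_S d = Σ_T d`.

Proof.  The support of `Γ_i(y)` lies in `{0} ∪ U ∪ (U + U)`, `U = ⋃_j supp y_j`, `|U| ≤ sB`
(part C), so `d_i = u_i + v_i` with `u_i, v_i ∈ V := {0} ∪ U`.  If `d` is not injective the
relation is trivial.  Otherwise the indices with `u_i ≠ v_i` are `≥ m - |V|` distinct proper edges
of a graph on `|V| ≤ sB + 1` vertices (loops `u_i = v_i` inject into `V`); a subgraph of minimum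
degree `δ = t + 30` exists by the max-`(#pairs - 2δ|W|)` argument (part B), and part A
(`GirthSidonSparseSwallowForcesShortRelationPaths`: Moore count of vertex-simple paths + pigeonhole
+ telescoping of alternating label sums along two equal-length paths with the same endpoints)
gives the relation with `k = 30`.  Part D is the arithmetic: for `m ≥ 4098^25` and
`a^20 ≤ m^19` there is `t` with `a + 1 < t^30` and `(2t+61)(a+1) < m`.

This replaces the even-cycle (Bondy–Simonovits, item `ShortEvenCycle`) step of the route text by
the two-paths pigeonhole, which needs no bipartite reduction; the constants `20/19`, `30` of the
item are kept, `m₀ = 4098^25`.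
-/

-- `Summit.ValiantsHypothesis.ValiantsHypothesis.…` is the tree's mandated single-conjunct layout
-- (Sub = Summit), so the duplicated namespace component is intended.
set_option linter.dupNamespace false

namespace Summit.ValiantsHypothesis.ValiantsHypothesis.Theorems.GirthSidonSparse

variable {ι : Type*}

/-! ## Part B: a subgraph of large minimum degree, and the labelled core -/

/-- Every finite graph (here: a symmetric relation on a finite set `V ⊂ ℤ`) whose number of ordered
adjacent pairs exceeds `2 δ |V|` has a nonempty induced subgraph of minimum degree `≥ δ`:
maximise `#pairs(W) - 2δ|W|` over `W ⊆ V`. -/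
theorem exists_dense_subset (V : Finset ℤ) (Adj : ℤ → ℤ → Prop) [DecidableRel Adj]
    (hsymm : ∀ b c, Adj b c → Adj c b) (δ : ℕ)
    (hδ : 2 * δ * V.card < ((V ×ˢ V).filter fun x : ℤ × ℤ => Adj x.1 x.2).card) :
    ∃ W ⊆ V, W.Nonempty ∧ ∀ c ∈ W, δ ≤ (W.filter fun b => Adj b c).card := by
  set A : Finset ℤ → Finset (ℤ × ℤ) := fun W => (W ×ˢ W).filter fun x : ℤ × ℤ => Adj x.1 x.2
    with hA
  let F : Finset ℤ → ℤ := fun W => ((A W).card : ℤ) - 2 * δ * W.card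
  obtain ⟨W, hWV, hmax⟩ := Finset.exists_max_image V.powerset F ⟨V, Finset.mem_powerset_self V⟩
  rw [Finset.mem_powerset] at hWV
  have hFV : 0 < F V := by
    have : ((2 * δ * V.card : ℕ) : ℤ) < ((A V).card : ℤ) := by exact_mod_cast hδ
    simp only [F]
    push_cast at this
    linarith
  have hFW : 0 < F W := lt_of_lt_of_le hFV (hmax V (Finset.mem_powerset_self V))
  have hWne : W.Nonempty := by
    rw [Finset.nonempty_iff_ne_empty]; rintro rfl; simp [F, hA] at hFW
  refine ⟨W, hWV, hWne, fun c hc => ?_⟩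
  have hle := hmax (W.erase c) (Finset.mem_powerset.2 ((W.erase_subset c).trans hWV))
  -- every adjacent pair inside `W` is inside `W \ {c}` or has `c` as one of its entries
  have hcov : A W ⊆ A (W.erase c) ∪ ((W.filter fun b => Adj b c).image fun b => (b, c)) ∪
      ((W.filter fun b => Adj b c).image fun b => (c, b)) := by
    rintro ⟨x, y⟩ hxy
    simp only [hA, Finset.mem_filter, Finset.mem_product] at hxy
    obtain ⟨⟨hx, hy⟩, hadj⟩ := hxy
    simp only [hA, Finset.mem_union, Finset.mem_filter, Finset.mem_product, Finset.mem_erase,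
      Finset.mem_image, Prod.mk.injEq]
    by_cases hyc : y = c
    · subst hyc
      exact Or.inl (Or.inr ⟨x, ⟨hx, hadj⟩, rfl, rfl⟩)
    by_cases hxc : x = c
    · subst hxc
      exact Or.inr ⟨y, ⟨hy, hsymm _ _ hadj⟩, rfl, rfl⟩
    · exact Or.inl (Or.inl ⟨⟨⟨hxc, hx⟩, ⟨hyc, hy⟩⟩, hadj⟩)
  have hcard : (A W).card ≤ (A (W.erase c)).card + (W.filter fun b => Adj b c).card +
      (W.filter fun b => Adj b c).card := by
    calc (A W).card ≤ _ := Finset.card_le_card hcov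
      _ ≤ (A (W.erase c) ∪ ((W.filter fun b => Adj b c).image fun b => (b, c))).card +
            ((W.filter fun b => Adj b c).image fun b => (c, b)).card := Finset.card_union_le _ _
      _ ≤ (A (W.erase c)).card + ((W.filter fun b => Adj b c).image fun b => (b, c)).card +
            ((W.filter fun b => Adj b c).image fun b => (c, b)).card :=
          Nat.add_le_add_right (Finset.card_union_le _ _) _
      _ ≤ _ := by gcongr <;> exact Finset.card_image_le
  have hWc : (W.erase c).card = W.card - 1 := Finset.card_erase_of_mem hc
  have h1 : 1 ≤ W.card := Finset.card_pos.2 ⟨c, hc⟩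
  simp only [F, hWc, Nat.cast_sub h1, Nat.cast_one] at hle
  have hcard' : ((A W).card : ℤ) ≤ (A (W.erase c)).card + (W.filter fun b => Adj b c).card +
      (W.filter fun b => Adj b c).card := by exact_mod_cast hcard
  have : (δ : ℤ) ≤ (W.filter fun b => Adj b c).card := by linarith
  exact_mod_cast this

/-- **Labelled core.**  Indices `i` carry weights `d i = u i + v i` with `d` injective and
`u i, v i` in a finite set `V ⊂ ℤ`; `E` is a set of indices with `u i ≠ v i` ("proper edges" of
the graph on `V`).  If `|E| > 2δ|V|` and `|V| < (δ - k)^k` then some two different multisets of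
indices of size `≤ k` have equal `d`-sums. -/
theorem exists_relation_core [DecidableEq ι] (d u v : ι → ℤ) (hsum : ∀ i, d i = u i + v i)
    (hinj : Function.Injective d) (V : Finset ℤ) (E : Finset ι)
    (hE : ∀ i ∈ E, u i ∈ V ∧ v i ∈ V ∧ u i ≠ v i) (δ k : ℕ)
    (hδ : 2 * δ * V.card < E.card) (hk : V.card < (δ - k) ^ k) :
    ∃ S T : Multiset ι, S ≠ T ∧ Multiset.card S ≤ k ∧ Multiset.card T ≤ k ∧
      (S.map d).sum = (T.map d).sum := by
  classical
  have hEne : E.Nonempty := by rw [← Finset.card_pos]; omega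
  obtain ⟨i₀, _⟩ := hEne
  let Adj : ℤ → ℤ → Prop := fun b c => b ≠ c ∧ ∃ i, (u i = b ∧ v i = c) ∨ (u i = c ∧ v i = b)
  have hsymm : ∀ b c, Adj b c → Adj c b := fun b c ⟨hne, i, hi⟩ => ⟨hne.symm, i, hi.symm⟩
  -- the proper edges inject into the ordered adjacent pairs
  have hAE : E.card ≤ ((V ×ˢ V).filter fun x : ℤ × ℤ => Adj x.1 x.2).card := by
    refine Finset.card_le_card_of_injOn (fun i => (u i, v i)) ?_ ?_
    · intro i hi
      obtain ⟨hu, hv, hne⟩ := hE i hi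
      simp only [Finset.coe_filter, Finset.mem_product, Set.mem_setOf_eq]
      exact ⟨⟨hu, hv⟩, hne, i, Or.inl ⟨rfl, rfl⟩⟩
    · intro i _ j _ hij
      simp only [Prod.mk.injEq] at hij
      apply hinj
      rw [hsum i, hsum j, hij.1, hij.2]
  obtain ⟨W, hWV, ⟨a, ha⟩, hdeg⟩ := exists_dense_subset V Adj hsymm δ (lt_of_lt_of_le hδ hAE)
  let nbr : ℤ → Finset ℤ := fun c => W.filter fun b => Adj b c
  let lab : ℤ → ℤ → ι := fun b c =>
    if h : ∃ i, (u i = b ∧ v i = c) ∨ (u i = c ∧ v i = b) then h.choose else i₀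
  have hlab_spec : ∀ b c, b ∈ nbr c →
      (u (lab b c) = b ∧ v (lab b c) = c) ∨ (u (lab b c) = c ∧ v (lab b c) = b) := by
    intro b c hbc
    simp only [nbr, Finset.mem_filter] at hbc
    obtain ⟨_, _, hex⟩ := hbc
    simp only [lab, dif_pos hex]
    exact hex.choose_spec
  have hlab1 : ∀ b c, b ∈ nbr c → d (lab b c) = b + c := by
    intro b c hbc
    rcases hlab_spec b c hbc with ⟨h1, h2⟩ | ⟨h1, h2⟩ <;> rw [hsum, h1, h2]
    ring
  have hlab2 : ∀ b c y z, b ∈ nbr c → y ∈ nbr z → lab b c = lab y z → b = y ∨ b = z := by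
    intro b c y z hbc hyz heq
    have h1 := hlab_spec b c hbc
    have h2 := hlab_spec y z hyz
    rw [heq] at h1
    rcases h1 with ⟨h1, _⟩ | ⟨_, h1⟩ <;> rcases h2 with ⟨h2, h3⟩ | ⟨h2, h3⟩
    · exact Or.inl (h1.symm.trans h2)
    · exact Or.inr (h1.symm.trans h2)
    · exact Or.inr (h1.symm.trans h3)
    · exact Or.inl (h1.symm.trans h3)
  have hnW : ∀ c, nbr c ⊆ W := fun c => Finset.filter_subset _ _
  have hWcard : W.card < (δ - k) ^ k := lt_of_le_of_lt (Finset.card_le_card hWV) hk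
  exact exists_relation_of_minDegree lab nbr d hlab1 hlab2 W hnW δ k hdeg a ha hWcard

/-! ## Part C: supports of quadratic expressions in sparse Laurent polynomials -/

open scoped Pointwise in
/-- If `Γ` has total degree `≤ 2` and every `y j` is supported in `U`, then every exponent in the
support of `Γ(y)` is a sum of two elements of `U ∪ {0}`. -/
theorem exists_add_of_mem_support {σ : Type*} [Fintype σ] [DecidableEq σ]
    (Γ : MvPolynomial σ ℂ) (hΓ : Γ.totalDegree ≤ 2)
    (y : σ → LaurentPolynomial ℂ) (U : Finset ℤ) (hU : ∀ j, (y j).coeff.support ⊆ U)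
    (n : ℤ) (hn : n ∈ (MvPolynomial.aeval y Γ).coeff.support) :
    ∃ a ∈ insert (0 : ℤ) U, ∃ b ∈ insert (0 : ℤ) U, n = a + b := by
  classical
  -- `R t x`: `x` is a sum of `t` elements of `U`
  let R : ℕ → ℤ → Prop := fun t x =>
    ∃ M : Multiset ℤ, Multiset.card M = t ∧ (∀ z ∈ M, z ∈ U) ∧ M.sum = x
  have R0 : R 0 0 := ⟨0, rfl, by simp, by simp⟩
  have Radd : ∀ s t x x', R s x → R t x' → R (s + t) (x + x') := by
    rintro s t x x' ⟨M, hM, hMU, rfl⟩ ⟨N, hN, hNU, rfl⟩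
    refine ⟨M + N, by simp [hM, hN], ?_, by simp⟩
    intro z hz
    rcases Multiset.mem_add.1 hz with h | h
    exacts [hMU z h, hNU z h]
  have Rone : ∀ x ∈ (1 : LaurentPolynomial ℂ).coeff.support, R 0 x := by
    intro x hx
    have hx' := AddMonoidAlgebra.support_coeff_one_subset hx
    rw [Finset.mem_zero] at hx'
    subst hx'
    exact R0
  -- powers
  have Rpow : ∀ f : LaurentPolynomial ℂ, f.coeff.support ⊆ U →
      ∀ t : ℕ, ∀ x ∈ (f ^ t).coeff.support, R t x := by
    intro f hf t
    induction t with
    | zero =>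
        intro x hx
        rw [pow_zero] at hx
        exact Rone x hx
    | succ t ih =>
        intro x hx
        rw [pow_succ] at hx
        have hx' := AddMonoidAlgebra.support_coeff_mul_subset _ _ hx
        rw [Finset.mem_add] at hx'
        obtain ⟨x1, hx1, x2, hx2, rfl⟩ := hx'
        exact Radd _ _ _ _ (ih x1 hx1) ⟨{x2}, by simp, by simpa using hf hx2, by simp⟩
  -- products over a set of indices
  have Rprod : ∀ (e : σ → ℕ) (J : Finset σ),
      ∀ x ∈ (∏ j ∈ J, y j ^ e j).coeff.support, R (∑ j ∈ J, e j) x := by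
    intro e J
    induction J using Finset.induction_on with
    | empty =>
        intro x hx
        rw [Finset.prod_empty] at hx
        rw [Finset.sum_empty]
        exact Rone x hx
    | insert j J hj ih =>
        intro x hx
        rw [Finset.prod_insert hj] at hx
        have hx' := AddMonoidAlgebra.support_coeff_mul_subset _ _ hx
        rw [Finset.mem_add] at hx'
        obtain ⟨x1, hx1, x2, hx2, rfl⟩ := hx'
        rw [Finset.sum_insert hj]
        exact Radd _ _ _ _ (Rpow (y j) (hU j) (e j) x1 hx1) (ih x2 hx2)
  -- expand `aeval`
  rw [MvPolynomial.aeval_def, MvPolynomial.eval₂_eq', AddMonoidAlgebra.coeff_sum] at hn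
  obtain ⟨e, he, hn⟩ := Finsupp.mem_support_finsetSum n hn
  rw [← Algebra.smul_def, AddMonoidAlgebra.coeff_smul] at hn
  have hn' := Finsupp.support_smul hn
  obtain ⟨M, hM, hMU, hMsum⟩ := Rprod (fun j => e j) Finset.univ n hn'
  have hdeg : ∑ j, e j ≤ 2 := by
    have h := MvPolynomial.le_totalDegree he
    rw [Finsupp.sum_fintype _ _ (fun _ => rfl)] at h
    exact h.trans hΓ
  rw [← hM] at hdeg
  have hcases : Multiset.card M = 0 ∨ Multiset.card M = 1 ∨ Multiset.card M = 2 := by omega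
  rcases hcases with h | h | h
  · rw [Multiset.card_eq_zero] at h
    subst h
    simp only [Multiset.sum_zero] at hMsum
    exact ⟨0, Finset.mem_insert_self _ _, 0, Finset.mem_insert_self _ _, by simp [← hMsum]⟩
  · rw [Multiset.card_eq_one] at h
    obtain ⟨z, rfl⟩ := h
    simp only [Multiset.sum_singleton] at hMsum
    exact ⟨z, Finset.mem_insert_of_mem (hMU z (by simp)), 0, Finset.mem_insert_self _ _,
      by simp [← hMsum]⟩
  · rw [Multiset.card_eq_two] at h
    obtain ⟨z, w, rfl⟩ := h
    simp only [Multiset.insert_eq_cons, Multiset.sum_cons, Multiset.sum_singleton] at hMsum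
    exact ⟨z, Finset.mem_insert_of_mem (hMU z (by simp)), w,
      Finset.mem_insert_of_mem (hMU w (by simp)), hMsum.symm⟩

/-! ## Part D: the arithmetic of the exponents `(sB)^20 ≤ m^19` -/

/-- For `m ≥ 4098^25` and `a^20 ≤ m^19` (think `a = sB ≤ m^{0.95}`) there is `t` (about `m^{1/25}`)
with `a + 1 < t^30` and `(2t + 61)(a + 1) < m`. -/
theorem exists_t_of_pow_le (m a : ℕ) (hm : 4098 ^ 25 ≤ m) (ha : a ^ 20 ≤ m ^ 19) :
    ∃ t : ℕ, a + 1 < t ^ 30 ∧ (2 * t + 61) * (a + 1) < m := by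
  classical
  set t := Nat.findGreatest (fun t => t ^ 25 ≤ m) m with ht_def
  have ht : t ^ 25 ≤ m :=
    Nat.findGreatest_spec (P := fun t => t ^ 25 ≤ m) (m := 0) (Nat.zero_le m) (by norm_num)
  have htm : t ≤ m := Nat.findGreatest_le m
  have h1m : 1 < m := lt_of_lt_of_le (by norm_num) hm
  have htlt : t < m := by
    rcases lt_or_eq_of_le htm with h | h
    · exact h
    · rw [h] at ht
      have h2 : m < m ^ 2 := by nlinarith
      have h3 : m ^ 2 ≤ m ^ 25 := Nat.pow_le_pow_right (by omega) (by norm_num)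
      omega
  have ht1 : m < (t + 1) ^ 25 := by
    have := Nat.findGreatest_is_greatest (P := fun t => t ^ 25 ≤ m) (Nat.lt_succ_self t)
      (by omega : t + 1 ≤ m)
    simpa using this
  clear_value t
  have ht4 : 4098 ≤ t := by
    by_contra h
    have : (t + 1) ^ 25 ≤ 4098 ^ 25 := Nat.pow_le_pow_left (by omega) 25
    omega
  have htpos : 0 < t := by omega
  have hmpos : 0 < m := by omega
  have hN : (a + 1) ^ 20 ≤ 2 ^ 20 * m ^ 19 := by
    rcases Nat.eq_zero_or_pos a with rfl | hapos
    · have : 1 ≤ 2 ^ 20 * m ^ 19 :=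
        Nat.one_le_iff_ne_zero.2 (Nat.mul_ne_zero (by norm_num) (pow_ne_zero _ (by omega)))
      simpa using this
    · calc (a + 1) ^ 20 ≤ (2 * a) ^ 20 := Nat.pow_le_pow_left (by omega) 20
        _ = 2 ^ 20 * a ^ 20 := by rw [mul_pow]
        _ ≤ 2 ^ 20 * m ^ 19 := Nat.mul_le_mul_left _ ha
  refine ⟨t, ?_, ?_⟩
  · -- `a + 1 < t^30`, from `(a+1)^20 ≤ 2^20 m^19 < 2^20 (t^30)^19 ≤ (t^30)^20`
    have h5t : 2 ^ 5 ≤ t := by norm_num; omega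
    have h2t : 2 ≤ t := by omega
    have hmt : m < t ^ 30 :=
      calc m < (t + 1) ^ 25 := ht1
        _ ≤ (2 * t) ^ 25 := Nat.pow_le_pow_left (by omega) 25
        _ = 2 ^ 25 * t ^ 25 := by rw [mul_pow]
        _ ≤ t ^ 5 * t ^ 25 := by
            refine Nat.mul_le_mul_right _ ?_
            calc 2 ^ 25 = (2 ^ 5) ^ 5 := by rw [← pow_mul]
              _ ≤ t ^ 5 := Nat.pow_le_pow_left h5t 5
        _ = t ^ 30 := by rw [← pow_add]
    have h2030 : 2 ^ 20 ≤ t ^ 30 :=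
      (Nat.pow_le_pow_left h2t 20).trans (Nat.pow_le_pow_right htpos (by norm_num))
    have key : (a + 1) ^ 20 < (t ^ 30) ^ 20 :=
      calc (a + 1) ^ 20 ≤ 2 ^ 20 * m ^ 19 := hN
        _ < 2 ^ 20 * (t ^ 30) ^ 19 :=
            Nat.mul_lt_mul_of_pos_left (Nat.pow_lt_pow_left hmt (by norm_num)) (Nat.two_pow_pos 20)
        _ ≤ t ^ 30 * (t ^ 30) ^ 19 := Nat.mul_le_mul_right _ h2030
        _ = (t ^ 30) ^ 20 := by rw [← pow_succ']
    exact (Nat.pow_lt_pow_iff_left (by norm_num)).1 key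
  · -- `(2t+61)(a+1) < m`, from `((2t+61)(a+1))^20 ≤ (4t)^20 2^20 m^19 < t^25 m^19 ≤ m^20`
    have h12 : 2 ^ 12 < t := by norm_num; omega
    have h5 : 2 ^ 60 < t ^ 5 :=
      calc 2 ^ 60 = (2 ^ 12) ^ 5 := by rw [← pow_mul]
        _ < t ^ 5 := Nat.pow_lt_pow_left h12 (by norm_num)
    have hpos : 0 < t ^ 20 * m ^ 19 := Nat.mul_pos (Nat.pow_pos htpos) (Nat.pow_pos hmpos)
    have e3 : (4 * t) ^ 20 * (2 ^ 20 * m ^ 19) = 2 ^ 60 * (t ^ 20 * m ^ 19) := by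
      rw [mul_pow, mul_mul_mul_comm, show (4 : ℕ) = 2 ^ 2 from rfl, ← pow_mul, ← pow_add]
    have e4 : t ^ 5 * (t ^ 20 * m ^ 19) = t ^ 25 * m ^ 19 := by
      rw [← mul_assoc, ← pow_add]
    have key : ((2 * t + 61) * (a + 1)) ^ 20 < m ^ 20 :=
      calc ((2 * t + 61) * (a + 1)) ^ 20 = (2 * t + 61) ^ 20 * (a + 1) ^ 20 := mul_pow _ _ _
        _ ≤ (4 * t) ^ 20 * (2 ^ 20 * m ^ 19) :=
            Nat.mul_le_mul (Nat.pow_le_pow_left (by omega) 20) hN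
        _ = 2 ^ 60 * (t ^ 20 * m ^ 19) := e3
        _ < t ^ 5 * (t ^ 20 * m ^ 19) := Nat.mul_lt_mul_of_pos_right h5 hpos
        _ = t ^ 25 * m ^ 19 := e4
        _ ≤ m * m ^ 19 := Nat.mul_le_mul_right _ ht
        _ = m ^ 20 := by rw [← pow_succ']
    exact (Nat.pow_lt_pow_iff_left (by norm_num)).1 key

end Summit.ValiantsHypothesis.ValiantsHypothesis.Theorems.GirthSidonSparse

/-! ## Part E: the route item -/

namespace Summit.ValiantsHypothesis.ValiantsHypothesis.Theorems

open GirthSidonSparse in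
/-- **SparseSwallowForcesShortRelation** (item `stmt-ValiantsHypothesis-6539`, route GirthSidon):
if a quadratic map `Γ : ℂ^s → ℂ^m` formally swallows the monomial curve `(x^{d_i})_i` along Laurent
polynomials `y_j` with at most `B` terms each and `(sB)^20 ≤ m^19`, `m` large, then the exponents
admit a short additive relation: multisets `S ≠ T` of indices of size `≤ 30` with `Σ_S d = Σ_T d`.
Proof: `d_i = u_i + v_i` with `u_i, v_i ∈ V := {0} ∪ ⋃ supp y_j`, `|V| ≤ sB + 1`; non-injective
`d` is trivial; loops `u_i = v_i` are at most `|V|`; the remaining `≥ m - |V|` proper edges on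
`|V|` vertices contain (dense subgraph + Moore count with `k = 30`) two distinct equal-length paths
with the same endpoints, whose alternating label sums give the relation. -/
theorem sparseSwallowForcesShortRelation_proof :
    Summit.ValiantsHypothesis.ValiantsHypothesis.Theses.GirthSidon.SparseSwallowForcesShortRelation := by
  unfold Summit.ValiantsHypothesis.ValiantsHypothesis.Theses.GirthSidon.SparseSwallowForcesShortRelation
  refine ⟨4098 ^ 25, fun m hm d s B hsB Γ y hΓ hy heq => ?_⟩
  classical
  -- degenerate case: two equal exponents
  by_cases hinj : Function.Injective d
  swap
  · simp only [Function.Injective, not_forall] at hinj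
    obtain ⟨i, i', hdi, hne⟩ := hinj
    refine ⟨{i}, {i'}, ?_, by simp, by simp, by simpa using hdi⟩
    simpa using hne
  -- the vertex set `V = {0} ∪ ⋃ supp y_j`
  let U : Finset ℤ := Finset.univ.biUnion fun j => (y j).coeff.support
  have hUcard : U.card ≤ s * B :=
    calc U.card ≤ ∑ j, (y j).coeff.support.card := Finset.card_biUnion_le
      _ ≤ ∑ _j : Fin s, B := Finset.sum_le_sum fun j _ => hy j
      _ = s * B := by simp
  let V : Finset ℤ := insert 0 U
  have hVcard : V.card ≤ s * B + 1 := (Finset.card_insert_le _ _).trans (by omega)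
  -- every exponent is a sum of two vertices
  have hrep : ∀ i : Fin m, ∃ a ∈ V, ∃ b ∈ V, (d i : ℤ) = a + b := by
    intro i
    apply exists_add_of_mem_support (Γ i) (hΓ i) y U
      (fun j => Finset.subset_biUnion_of_mem (fun j => (y j).coeff.support) (Finset.mem_univ j))
    rw [heq i, Finsupp.mem_support_iff, LaurentPolynomial.T_apply, if_pos rfl]
    exact one_ne_zero
  choose u hu v hv huv using hrep
  -- proper edges `E` and loops `L`
  let E : Finset (Fin m) := Finset.univ.filter fun i => u i ≠ v i
  let L : Finset (Fin m) := Finset.univ.filter fun i => u i = v i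
  have hLcard : L.card ≤ V.card := by
    refine Finset.card_le_card_of_injOn u (fun i _ => hu i) ?_
    intro i hi j hj hij
    simp only [L, Finset.coe_filter, Finset.mem_univ, true_and, Set.mem_setOf_eq] at hi hj
    apply hinj
    have h : (d i : ℤ) = d j := by rw [huv i, huv j, ← hi, ← hj, hij]
    exact_mod_cast h
  have hELcard : E.card + L.card = m := by
    have h := Finset.card_filter_add_card_filter_not (s := (Finset.univ : Finset (Fin m)))
      (fun i : Fin m => u i ≠ v i)
    simp only [ne_eq, not_not, Finset.card_univ, Fintype.card_fin] at h
    exact h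
  -- the arithmetic
  obtain ⟨t, ht1, ht2⟩ := exists_t_of_pow_le m (s * B) hm hsB
  have hdinj : Function.Injective (fun i : Fin m => (d i : ℤ)) :=
    (Nat.cast_injective (R := ℤ)).comp hinj
  -- `2 (t + 30) |V| < |E|`
  have hδ : 2 * (t + 30) * V.card < E.card := by
    have hX : 2 * (t + 30) * V.card ≤ 2 * (t + 30) * (s * B + 1) := Nat.mul_le_mul_left _ hVcard
    have hQ : (2 * t + 61) * (s * B + 1) = 2 * (t + 30) * (s * B + 1) + (s * B + 1) := by ring
    omega
  -- `|V| < t^30`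
  have hk : V.card < (t + 30 - 30) ^ 30 := by
    rw [Nat.add_sub_cancel]
    omega
  obtain ⟨S, T, hST, hS, hT, hsumeq⟩ := exists_relation_core (fun i : Fin m => (d i : ℤ)) u v huv
    hdinj V E (fun i hi => ⟨hu i, hv i, by simpa [E] using hi⟩) (t + 30) 30 hδ hk
  refine ⟨S, T, hST, hS, hT, ?_⟩
  have h1 : (((S.map d).sum : ℕ) : ℤ) = (S.map fun i => (d i : ℤ)).sum := by
    rw [Nat.cast_multiset_sum, Multiset.map_map]; rfl
  have h2 : (((T.map d).sum : ℕ) : ℤ) = (T.map fun i => (d i : ℤ)).sum := by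
    rw [Nat.cast_multiset_sum, Multiset.map_map]; rfl
  have h : (((S.map d).sum : ℕ) : ℤ) = (T.map d).sum := by rw [h1, h2, hsumeq]
  exact_mod_cast h

end Summit.ValiantsHypothesis.ValiantsHypothesis.Theorems
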